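import Literature.NumberTheory.EllipticCurves.MordellCurveThreeDescentKernel
import HarnessLib

/-!
# Local conditions for the torsor classes `[C_a] ∈ H¹(K, E_D)` of the Mordell curves `y² = x³ − 3c²`

Topic `NumberTheory/EllipticCurves`. Third file of the programme (after `MordellCurveThreeDescent`,
the classes `[C_a]`, and `MordellCurveThreeDescentKernel`, their kernel) towards
`Literature.Barriers.BirchSwinnertonDyer.Cassels1964_sha_threeRank_jZero` (Cassels 1964,
*Arithmetic on curves of genus 1, VI*), recorded in
`Literature/Barriers/BirchSwinnertonDyer/DescentDefectUnboundedCasselsProofs.lean`. Everything here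
is proved; no named facts.

**The local condition** (`MordellDescent.torsorClass_mem_localRestrictionKer`). Let `E` be a
`K`-field — a completion `K_v`, the fields at which the tree's `Ш = WeierstrassCurve.sha` is defined
(file `Sha`). If `a ∈ δ(E'(E)) · E*³`, i.e. `phiDescent c P' = a w³` for some `P' ∈ E'(E)`,
`w ∈ E*` (`E' = E_{81c²}`, `δ(X, Y) = Y + 9c` — for Cassels' curves: the torsor
`a x³ + a⁻¹ y³ + d z³ = 0` has a point over `K_v`), then `[C_a]` lies in the local kernel
`WeierstrassCurve.localRestrictionKer (mordellCurve D) E` of `H¹(K, E_D) → H¹(E, E_D(Ē))`. This is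
the compatibility of the `φ`-descent with localisation that makes
`Sel^φ(E_D/K) → Ш(E_D/K)[φ]` well defined, place by place ("`m` maps into an element of `Ш` if
and only if there is everywhere locally a point on (2)", Cassels p. 65, the "if" half).

Proof (cubic analogue of `KramerShaG.kramerXi_mem_localRestrictionKer`). The restricted cocycle
`τ ↦ n_a(τ|_K̄) T_E` (`pointsMap_torsorCocycle`; `T_E = (0, c ι√−3)` the image of `T`,
`pointsMap_torsT`, generator of the kernel of the local Vélu pair `isVeluThreePair_local`) is the
coboundary `τ b − b` of an explicit local point `b ∈ E_D(Ē)`: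
* `P' = O` (`a w³ = 1`): `ι∛a = ι(ω)^j w⁻¹` for some `j` (cube roots of unity in `Ē`), so
  `n_a(τ) = (e(τ) − 1) j` and `b = jT_E`;
* `P' = −T' = (0, −9c)` (`(18c)² = a w³`): `b = ((w/3) ι∛a, −3c)`, a point with `x_b³ = 12c²`;
* `P' = (X₀, Y₀)` otherwise (`Y₀ + 9c = a w³`): `b` = the explicit `φ`-preimage of `P'`
  (`preimX`, `preimY` of the kernel file) with `g_c(b) = w ι∛a`;
in the last two cases `τ b = b + n_a(τ) T_E` because `τ` multiplies `ι∛a` by `ι(ω)^{n_a(τ)}`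
(`galAutE_iotaE_cubeRoot`, transport of the Kummer cocycle along `closureEmb`/`resGal`), translation
by `T_E` multiplies `g_{±c}` by `ι(ω)^{±1}` (`gFunW_add_nsmul_T`), and an affine point off the
kernel is determined by `(g_c, g_{−c})` (`coords_eq_of_gFunW`).

Also here: the local set-up (`galAutE`, `iotaE`, `iotaE_galAut_resGal`, `smul_localPoints_some`,
`pointsMap_some`, `thetaE`, `cE`, `isVeluThreePair_local`, `pointsMap_torsT`), `K`-general versions
of the `ℚ`-specific helpers of `KramerDescentShaGProofs`.

What is NOT here: the place-by-place verification of the hypothesis for Cassels' `d` (`K = ℚ`,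
`D = −432d²`: p. 66, "the only `p`-adic fields in which there might not be points on (2) are the
`3`-adic field and the `q`-adic fields with `q | d`"), and everything global.

## References

* [Cassels1964ArithmeticVI] J. W. S. Cassels, *Arithmetic on curves of genus 1. VI. The
  Tate–Šafarevič group can be arbitrarily large*, J. reine angew. Math. 214/215 (1964) 65–70,
  pp. 65–66.
* [SilvermanAEC2009] J. H. Silverman, *The Arithmetic of Elliptic Curves*, 2nd ed., GTM 106,
  X.§4 (the local conditions defining `Sel^φ` and `Ш`, Thm. X.4.2).
* Template in the tree: `Literature.NumberTheory.EllipticCurves.KramerDescentShaGProofs`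
  (`KramerShaG.kramerXi_mem_localRestrictionKer`).
-/

noncomputable section

open scoped Classical

open WeierstrassCurve

universe u

namespace Literature.NumberTheory.EllipticCurves

namespace MordellDescent

variable {K : Type u} [Field K] [CharZero K]

/-! ## Local points: embeddings, restriction, and the local Vélu pair -/

section LocalSetup

variable {D c : K}
variable (E : Type u) [Field E] [Algebra K E]

/-- An element of `Γ_E` as an automorphism of `Ē` (by definition). [folklore] -/
def galAutE (τ : Field.absoluteGaloisGroup E) : AlgebraicClosure E ≃ₐ[E] AlgebraicClosure E := τ

/-- The chosen `K`-embedding `ι : K̄ → Ē` (the tree's `closureEmb`). [folklore] -/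
abbrev iotaE : AlgebraicClosure K →ₐ[K] AlgebraicClosure E := closureEmb (K := K) E

variable {E}

omit [CharZero K] in
/-- `ι ∘ (τ|_K̄) = τ ∘ ι` for the restriction `Γ_E → Γ_K` attached to `ι = closureEmb E`.
[folklore] -/
theorem iotaE_galAut_resGal (τ : Field.absoluteGaloisGroup E) (x : AlgebraicClosure K) :
    iotaE E (galAut (resGal (K := K) E τ) x) = galAutE E τ (iotaE E x) :=
  apply_resGalAuxOfEmb_apply (closureEmb (K := K) E) τ x

omit [CharZero K] in
/-- The local Galois action on an affine local point acts on coordinates. [folklore] -/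
theorem smul_localPoints_some {W : WeierstrassCurve K} (τ : Field.absoluteGaloisGroup E)
    {x y : AlgebraicClosure E} (h : (W.baseChange (AlgebraicClosure E)).toAffine.Nonsingular x y)
    (h' : (W.baseChange (AlgebraicClosure E)).toAffine.Nonsingular (galAutE E τ x) (galAutE E τ y)) :
    τ • (show localPoints W E from Affine.Point.some x y h) =
      Affine.Point.some (galAutE E τ x) (galAutE E τ y) h' := by
  rw [localPoints.smul_def]
  change Affine.Point.map _ (Affine.Point.some x y h) = _
  rw [Affine.Point.map_some]
  rfl

omit [CharZero K] in
/-- Nonsingularity is preserved by the local Galois action. [folklore] -/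
theorem nonsingular_galAutE {W : WeierstrassCurve K} (τ : Field.absoluteGaloisGroup E)
    {x y : AlgebraicClosure E} (h : (W.baseChange (AlgebraicClosure E)).toAffine.Nonsingular x y) :
    (W.baseChange (AlgebraicClosure E)).toAffine.Nonsingular (galAutE E τ x) (galAutE E τ y) :=
  (W.toAffine.baseChange_nonsingular
    ((AlgEquiv.restrictScalars K (galAutE E τ)) :
      AlgebraicClosure E →ₐ[K] AlgebraicClosure E).injective ..).mpr h

omit [CharZero K] in
/-- `pointsMap` acts on coordinates through `ι`. [folklore] -/
theorem pointsMap_some {W : WeierstrassCurve K} {x y : AlgebraicClosure K}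
    (h : (W.baseChange (AlgebraicClosure K)).toAffine.Nonsingular x y)
    (h' : (W.baseChange (AlgebraicClosure E)).toAffine.Nonsingular (iotaE E x) (iotaE E y)) :
    pointsMap W E (show geomPoints W from Affine.Point.some x y h) =
      (show localPoints W E from Affine.Point.some (iotaE E x) (iotaE E y) h') :=
  rfl

variable (K) in
/-- `√−3 ∈ Ē`: the image `ι(√−3)`. [folklore] -/
def thetaE (E : Type u) [Field E] [Algebra K E] : AlgebraicClosure E := iotaE (K := K) E (theta K)

omit [CharZero K] in
/-- `ι(√−3)² = −3`. [folklore] -/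
theorem thetaE_sq : thetaE K E ^ 2 = -3 := by
  rw [thetaE, ← map_pow, theta_sq, map_neg, map_ofNat]

/-- `c ∈ Ē`. [folklore] -/
def cE (E : Type u) [Field E] [Algebra K E] (c : K) : AlgebraicClosure E :=
  algebraMap K (AlgebraicClosure E) c

omit [CharZero K] in
/-- `ι(c̄) = c` in `Ē`. [folklore] -/
theorem iotaE_cbar (c : K) : iotaE E (cbar c) = cE E c := (iotaE E).commutes c

omit [CharZero K] in
/-- `ι(s) = c ι(√−3)`. [folklore] -/
theorem iotaE_sCoord (c : K) : iotaE E (sCoord c) = cE E c * thetaE K E := by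
  rw [sCoord_eq, map_mul, iotaE_cbar]; rfl

omit [CharZero K] in
/-- `Γ_E` fixes `c`. [folklore] -/
@[simp] theorem galAutE_cE (τ : Field.absoluteGaloisGroup E) (c : K) : galAutE E τ (cE E c) = cE E c := by
  rw [cE, IsScalarTower.algebraMap_apply K E (AlgebraicClosure E)]
  exact (galAutE E τ).commutes _

omit [CharZero K] in
/-- `c` in `Ē` through `E`. [folklore] -/
theorem cE_eq (c : K) : cE E c = algebraMap E (AlgebraicClosure E) (algebraMap K E c) :=
  IsScalarTower.algebraMap_apply K E (AlgebraicClosure E) c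

/-- **The local Vélu pair**: `(E_D, E_{81c²})` over `Ē` with parameters `(0, c ι(√−3))`.
[folklore] -/
theorem isVeluThreePair_local (hc : c ≠ 0) (hD : D = -3 * c ^ 2) :
    IsVeluThreePair (0 : AlgebraicClosure E) (cE E c * thetaE K E)
      ((mordellCurve D).baseChange (AlgebraicClosure E))
      ((mordellCurve (81 * c ^ 2)).baseChange (AlgebraicClosure E)) := by
  haveI : CharZero E := charZero_of_injective_algebraMap (algebraMap K E).injective
  have hθ := thetaE_sq (K := K) (E := E)
  have hcE : cE E c ≠ 0 := by
    rw [cE, map_ne_zero_iff _ (algebraMap K (AlgebraicClosure E)).injective]; exact hc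
  refine
    { a₁_eq := by rw [mordellCurve_baseChange]; rfl
      a₂_eq := by rw [mordellCurve_baseChange, mordellCurve_a₂]; ring
      a₃_eq := by rw [mordellCurve_baseChange]; rfl
      a₄_eq := by rw [mordellCurve_baseChange, mordellCurve_a₄]; ring
      a₆_eq := ?_
      a₁'_eq := by rw [mordellCurve_baseChange]; rfl
      a₂'_eq := by rw [mordellCurve_baseChange, mordellCurve_a₂]; ring
      a₃'_eq := by rw [mordellCurve_baseChange]; rfl
      a₄'_eq := by rw [mordellCurve_baseChange, mordellCurve_a₄]; ring
      a₆'_eq := ?_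
      Δ_ne := ?_ }
  · rw [mordellCurve_baseChange, mordellCurve_a₆, hD, map_mul, map_neg, map_pow, map_ofNat, mul_pow, hθ]
    change -3 * cE E c ^ 2 = _
    ring
  · rw [mordellCurve_baseChange, mordellCurve_a₆, map_mul, map_pow, map_ofNat, mul_pow, hθ]
    change 81 * cE E c ^ 2 = _
    ring
  · rw [mordellCurve_baseChange, mordellCurve_Δ, neg_ne_zero]
    refine mul_ne_zero (by norm_num) (pow_ne_zero 2 ?_)
    rw [map_ne_zero_iff _ (algebraMap K (AlgebraicClosure E)).injective, hD]
    exact mul_ne_zero (by norm_num) (pow_ne_zero 2 hc)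

/-- **The image of `T` in `E_D(Ē)` is the local kernel point `(0, c ι(√−3))`.** [folklore] -/
theorem pointsMap_torsT (hc : c ≠ 0) (hD : D = -3 * c ^ 2) :
    pointsMap (mordellCurve D) E (torsT hc hD) = (isVeluThreePair_local (E := E) hc hD).T := by
  have hV := isVeluThreePair_local (E := E) hc hD
  have h' : ((mordellCurve D).baseChange (AlgebraicClosure E)).toAffine.Nonsingular
      (iotaE E (0 : AlgebraicClosure K)) (iotaE E (sCoord c)) := by
    rw [map_zero, iotaE_sCoord]; exact hV.nonsingular_T
  rw [torsT_eq, pointsMap_some h h']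
  exact point_some_ext (map_zero _) (iotaE_sCoord c)
  where h := (isVeluThreePair_mordell hc hD).nonsingular_T

/-- `pointsMap (k T) = k T_E`. [folklore] -/
theorem pointsMap_nsmul_torsT (hc : c ≠ 0) (hD : D = -3 * c ^ 2) (k : ℕ) :
    pointsMap (mordellCurve D) E (k • torsT hc hD) = k • (isVeluThreePair_local (E := E) hc hD).T := by
  rw [map_nsmul, pointsMap_torsT]
  rfl

/-- **Transport of the Kummer cocycle**: `τ(ι∛a) = ι(ω)^{n} ι(∛a)` with `n = kummerExp a (τ|_K̄)`.
[folklore] -/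
theorem galAutE_iotaE_cubeRoot {a : K} (ha : a ≠ 0) (τ : Field.absoluteGaloisGroup E) :
    galAutE E τ (iotaE E (cubeRoot a)) =
      iotaE E (omega K) ^ (kummerExp a (resGal (K := K) E τ)).val * iotaE E (cubeRoot a) := by
  rw [← iotaE_galAut_resGal, galAut_cubeRoot ha, map_mul, map_pow]

/-- Transport of the cyclotomic sign: `τ(ι ω) = ι(ω)^{epsNat (τ|_K̄)}`. [folklore] -/
theorem galAutE_iotaE_omega (τ : Field.absoluteGaloisGroup E) :
    galAutE E τ (iotaE E (omega K)) = iotaE E (omega K) ^ epsNat (resGal (K := K) E τ) := by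
  rw [← iotaE_galAut_resGal, galAut_omega, map_pow]

omit [CharZero K] in
/-- `ι(ω) = (ι(√−3) − 1)/2`. [folklore] -/
theorem iotaE_omega : iotaE (K := K) E (omega K) = (thetaE K E - 1) / 2 := by
  rw [omega, map_div₀, map_sub, map_one, map_ofNat]; rfl

/-- `ι(ω)³ = 1`. [folklore] -/
theorem iotaE_omega_pow_three : iotaE (K := K) E (omega K) ^ 3 = 1 := by
  rw [← map_pow, omega_pow_three, map_one]

/-- **The restricted cocycle**: its value at `τ ∈ Γ_E`, pushed to `E_D(Ē)`, is `n T_E` with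
`n = kummerExp a (τ|_K̄)`. [folklore] -/
theorem pointsMap_torsorCocycle (hc : c ≠ 0) (hD : D = -3 * c ^ 2) {a : K} (ha : a ≠ 0)
    (τ : Field.absoluteGaloisGroup E) :
    pointsMap (mordellCurve D) E ((torsorCocycle hc hD ha).1 (resGal (K := K) E τ)) =
      (kummerExp a (resGal (K := K) E τ)).val • (isVeluThreePair_local (E := E) hc hD).T := by
  rw [torsorCocycle_apply, torsorFun, chiT_eq_val_nsmul, pointsMap_nsmul_torsT]

end LocalSetup

/-! ## More point-level algebra: translates stay off the kernel; coordinates from `(g_c, g_{−c})` -/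

section PointAlgebra2

variable {F : Type u} [Field F] {W W' : WeierstrassCurve F} {c θ : F}

/-- A point off the kernel `{O, ±T}` stays off the kernel after translation by a multiple of `T`:
it is affine with `x ≠ 0` (its image under `φ` is unchanged and non-zero). [folklore] -/
theorem exists_eq_some_of_add_nsmul_T (hV : IsVeluThreePair 0 (c * θ) W W') {x y : F}
    (h : W.toAffine.Nonsingular x y) (hx : x ≠ 0) (k : ℕ) :
    ∃ (x' y' : F) (h' : W.toAffine.Nonsingular x' y'),
      Affine.Point.some x y h + k • hV.T = Affine.Point.some x' y' h' ∧ x' ≠ 0 := by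
  have hker : hV.pointFun (Affine.Point.some x y h + k • hV.T) ≠ 0 := by
    rw [← hV.pointHom_apply, map_add, map_nsmul, hV.pointHom_apply, hV.pointHom_apply, hV.pointFun_T,
      smul_zero, add_zero, hV.pointFun_some _ hx]
    exact Affine.Point.some_ne_zero _
  rcases hQ : Affine.Point.some x y h + k • hV.T with _ | ⟨x', y', h'⟩
  · rw [hQ, ← Affine.Point.zero_def, hV.pointFun_zero] at hker
    exact absurd rfl hker
  · refine ⟨x', y', h', rfl, fun hx' => hker ?_⟩
    rw [hQ, hV.pointFun_some_of_eq_zero _ hx']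

/-- **An affine point off the kernel is determined by `(g_c, g_{−c})`**:
`x = 6c/(g_c − g_{−c})`, `y = g_c x − 3c`. [folklore] -/
theorem coords_eq_of_gFunW [CharZero F] (hc : c ≠ 0) {x y : F} (h : W.toAffine.Nonsingular x y) (hx : x ≠ 0) :
    x = 6 * c / (gFunW c (Affine.Point.some x y h) - gFunW (-c) (Affine.Point.some x y h)) ∧
      y = gFunW c (Affine.Point.some x y h) * x - 3 * c := by
  have h6 : (6 : F) * c ≠ 0 := mul_ne_zero (by norm_num) hc
  simp only [gFunW_some]
  constructor
  · rw [div_sub_div_same, show y + 3 * c - (y + 3 * -c) = 6 * c by ring, eq_div_iff (div_ne_zero h6 hx),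
      mul_div_cancel₀ _ hx]
  · rw [div_mul_cancel₀ _ hx]; ring

/-- `preimX` under ring homomorphisms. [folklore] -/
theorem map_preimX {F' : Type*} [Field F'] {G : Type*} [FunLike G F F'] [RingHomClass G F F']
    (f : G) (c X₀ γ : F) : f (preimX c X₀ γ) = preimX (f c) (f X₀) (f γ) := by
  simp only [preimX, map_div₀, map_mul, map_sub, map_ofNat]

/-- `preimY` under ring homomorphisms. [folklore] -/
theorem map_preimY {F' : Type*} [Field F'] {G : Type*} [FunLike G F F'] [RingHomClass G F F']
    (f : G) (c X₀ γ : F) : f (preimY c X₀ γ) = preimY (f c) (f X₀) (f γ) := by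
  simp only [preimY, map_sub, map_mul, map_ofNat, map_preimX]

end PointAlgebra2

/-! ## The local condition: `[C_a]` restricts to zero wherever `a ∈ δ(E'(E)) · E*³` -/

section Local

variable {D c : K} (hc : c ≠ 0) (hD : D = -3 * c ^ 2)
variable {E : Type u} [Field E] [Algebra K E]

/-- **The local condition.** Let `E` be a `K`-field (a completion `K_v`). If `a` lies in
`δ(E'(E)) · E*³` — there are `P' ∈ E'(E)` and `w ∈ E*` with `phiDescent c P' = a w³` over `E`
(for Cassels' curves: the torsor `a x³ + a⁻¹ y³ + d z³ = 0` has a point over `K_v`) — then the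
class `[C_a]` restricts to zero in `H¹(E, E_D(Ē))`: it lies in the local kernel
`WeierstrassCurve.localRestrictionKer` defining `Ш`. Proof: the restricted cocycle
`τ ↦ n_a(τ|_K̄) T` is the coboundary of an explicit local point `b ∈ E_D(Ē)`: `b = jT` if `a` is a
cube in `E` (`P' = O`, `ι∛a = ι(ω)^j w⁻¹`); `b = ((w/3) ι∛a, −3c)` if `P' = −T' = (0, −9c)`
(`(18c)² = a w³`, `x_b³ = 12c²`); and `b` the explicit `φ`-preimage of `P' = (X₀, Y₀)` with
`g_c(b) = w ι∛a` otherwise (`Y₀ + 9c = a w³`) — in each case `τ b = b + n_a(τ) T` because `τ`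
multiplies `ι∛a` by `ι(ω)^{n_a(τ)}` while translation by `T` multiplies `g_{±c}` by `ι(ω)^{±1}`
("`m` maps into an element of `Ш` if and only if there is everywhere locally a point on (2)",
p. 65: the "if" direction, place by place). [cite: Cassels1964ArithmeticVI, p. 65] -/
theorem torsorClass_mem_localRestrictionKer {a : K} (ha : a ≠ 0)
    (hloc : ∃ (P : (mordellCurve (81 * algebraMap K E c ^ 2)).toAffine.Point) (w : E),
      w ≠ 0 ∧ phiDescent (algebraMap K E c) P = algebraMap K E a * w ^ 3) :
    torsorClass hc hD ha ∈ (mordellCurve D).localRestrictionKer E := by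
  haveI : CharZero E := charZero_of_injective_algebraMap (algebraMap K E).injective
  have hV := isVeluThreePair_local (E := E) hc hD
  have hθ := thetaE_sq (K := K) (E := E)
  have hιinj : Function.Injective (iotaE (K := K) E) := (iotaE (K := K) E).toRingHom.injective
  have hcE0 : cE E c ≠ 0 := by
    rw [cE, map_ne_zero_iff _ (algebraMap K (AlgebraicClosure E)).injective]; exact hc
  have hω3 : iotaE (K := K) E (omega K) ^ 3 = 1 := iotaE_omega_pow_three
  have hωθ : iotaE (K := K) E (omega K) = (thetaE K E - 1) / 2 := iotaE_omega
  have hω0 : iotaE (K := K) E (omega K) ≠ 0 := fun h => by rw [h] at hω3; norm_num at hω3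
  have hω2 : ((-thetaE K E - 1) / 2) = iotaE (K := K) E (omega K) ^ 2 := by
    rw [hωθ]; field_simp; linear_combination -hθ
  have hα3 : iotaE (K := K) E (cubeRoot a) ^ 3 = algebraMap K (AlgebraicClosure E) a := by
    rw [← map_pow, cubeRoot_pow_three, AlgHom.commutes]
  have hα0 : iotaE (K := K) E (cubeRoot a) ≠ 0 := (map_ne_zero_iff _ hιinj).mpr (cubeRoot_ne_zero ha)
  have haE : algebraMap K (AlgebraicClosure E) a = algebraMap E (AlgebraicClosure E) (algebraMap K E a) :=
    IsScalarTower.algebraMap_apply K E (AlgebraicClosure E) a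
  have hcE' : cE E c = algebraMap E (AlgebraicClosure E) (algebraMap K E c) := cE_eq c
  -- how `τ ∈ Γ_E` moves `ι∛a` and fixes `E`
  have hτα : ∀ τ : Field.absoluteGaloisGroup E, galAutE E τ (iotaE (K := K) E (cubeRoot a)) =
      iotaE (K := K) E (omega K) ^ (kummerExp a (resGal (K := K) E τ)).val * iotaE (K := K) E (cubeRoot a) :=
    fun τ => galAutE_iotaE_cubeRoot ha τ
  have hτE : ∀ (τ : Field.absoluteGaloisGroup E) (e : E),
      galAutE E τ (algebraMap E (AlgebraicClosure E) e) = algebraMap E (AlgebraicClosure E) e := fun τ e =>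
    (galAutE E τ).commutes e
  have h3n : ∀ n : ℕ, (iotaE (K := K) E (omega K) ^ 2) ^ n * iotaE (K := K) E (omega K) ^ n = 1 := fun n => by
    rw [← pow_mul, ← pow_add, show 2 * n + n = 3 * n by ring, pow_mul, hω3, one_pow]
  -- the cocycle criterion
  unfold torsorClass WeierstrassCurve.localRestrictionKer
  rw [oneCocycleClass_mem_resKer_iff]
  obtain ⟨P, w, hw, hδ⟩ := hloc
  have hwE : algebraMap E (AlgebraicClosure E) w ≠ 0 := (map_ne_zero _).mpr hw
  rcases P with _ | ⟨X₀, Y₀, hP⟩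
  · /- `P' = O`: `a w³ = 1`, so `ι∛a = ι(ω)^j w⁻¹` and the cocycle is the coboundary of `jT` -/
    rw [← Affine.Point.zero_def, phiDescent_zero] at hδ
    have hz : (iotaE (K := K) E (cubeRoot a) * algebraMap E (AlgebraicClosure E) w) ^ 3 = 1 := by
      rw [mul_pow, hα3, haE, ← map_pow, ← map_mul, ← hδ, map_one]
    have hprim : IsPrimitiveRoot (iotaE (K := K) E (omega K)) 3 :=
      (isPrimitiveRoot_omega K).map_of_injective hιinj
    obtain ⟨j, -, hζ⟩ := hprim.eq_pow_of_pow_eq_one hz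
    have hαw : iotaE (K := K) E (cubeRoot a) =
        iotaE (K := K) E (omega K) ^ j * (algebraMap E (AlgebraicClosure E) w)⁻¹ := by
      rw [hζ, mul_inv_cancel_right₀ hwE]
    refine ⟨j • hV.T, fun τ => ?_⟩
    rw [pointsMap_torsorCocycle hc hD ha τ]
    -- `n(τ) = (e(τ) − 1) j` in `ℤ/3ℤ`
    have hexp : kummerExp a (resGal (K := K) E τ) =
        (eps (resGal (K := K) E τ) - 1) * (j : ZMod 3) := by
      have h1 := hτα τ
      rw [hαw, map_mul, map_inv₀, hτE, map_pow, galAutE_iotaE_omega, ← pow_mul, ← mul_assoc,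
        ← pow_add] at h1
      have h2 : iotaE (K := K) E (omega K) ^ (epsNat (resGal (K := K) E τ) * j) =
          iotaE (K := K) E (omega K) ^ ((kummerExp a (resGal (K := K) E τ)).val + j) :=
        mul_right_cancel₀ (inv_ne_zero hwE) h1
      have h3 : iotaE (K := K) E (omega K ^ (epsNat (resGal (K := K) E τ) * j)) =
          iotaE (K := K) E (omega K ^ ((kummerExp a (resGal (K := K) E τ)).val + j)) := by
        rw [map_pow, map_pow]; exact h2
      have h4 := (omega_pow_eq_pow_iff K).mp (hιinj h3)
      push_cast at h4
      rw [epsNat_cast, ZMod.natCast_zmod_val] at h4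
      linear_combination -h4
    -- the coboundary of `jT`, computed in `E_D(K̄)` and pushed forward along `pointsMap`
    have key : (kummerExp a (resGal (K := K) E τ)).val • hV.T =
        pointsMap (mordellCurve D) E (chiT hc hD (kummerExp a (resGal (K := K) E τ))) := by
      rw [chiT_eq_val_nsmul, pointsMap_nsmul_torsT]
    have key2 : (j • hV.T : localPoints (mordellCurve D) E) = pointsMap (mordellCurve D) E (chiT hc hD j) := by
      rw [chiT_natCast, pointsMap_nsmul_torsT]
    rw [key, hexp, chiT_eps_sub_one_mul, map_sub, pointsMap_smul, ← key2]
  · -- affine `P' = (X₀, Y₀)`; its equation over `E` and over `Ē`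
    have hE'E : Y₀ ^ 2 = X₀ ^ 3 + 81 * algebraMap K E c ^ 2 := (mordellCurve_equation_iff _ _ _).mp hP.left
    have hE'bar : algebraMap E (AlgebraicClosure E) Y₀ ^ 2 =
        algebraMap E (AlgebraicClosure E) X₀ ^ 3 + 81 * cE E c ^ 2 := by
      rw [hcE', ← map_pow, hE'E]; simp only [map_add, map_pow, map_mul, map_ofNat]
    rw [phiDescent_some] at hδ
    by_cases hY : Y₀ = -(9 * algebraMap K E c)
    · /- `P' = −T'`: `(18c)² = a w³`; `b = ((w/3) ι∛a, −3c)` with `x_b³ = 12c²` -/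
      rw [if_pos hY] at hδ
      have h1 : (w / 3) ^ 3 * algebraMap K E a = 12 * algebraMap K E c ^ 2 := by
        field_simp
        linear_combination -hδ
      have hxb3 : (algebraMap E (AlgebraicClosure E) (w / 3) * iotaE (K := K) E (cubeRoot a)) ^ 3 =
          12 * cE E c ^ 2 := by
        rw [mul_pow, hα3, haE, ← map_pow, ← map_mul, h1, map_mul, map_pow, map_ofNat, ← hcE']
      have hxb0 : algebraMap E (AlgebraicClosure E) (w / 3) * iotaE (K := K) E (cubeRoot a) ≠ 0 :=
        mul_ne_zero ((map_ne_zero _).mpr (div_ne_zero hw (by norm_num))) hα0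
      have hEqb : ((mordellCurve D).baseChange (AlgebraicClosure E)).toAffine.Equation
          (algebraMap E (AlgebraicClosure E) (w / 3) * iotaE (K := K) E (cubeRoot a)) (-(3 * cE E c)) := by
        rw [IsVeluPair.equation_iff' hV hθ]; linear_combination -hxb3
      have hnsb := (Affine.equation_iff_nonsingular_of_Δ_ne_zero hV.Δ_ne).mp hEqb
      refine ⟨Affine.Point.some _ _ hnsb, fun τ => ?_⟩
      rw [pointsMap_torsorCocycle hc hD ha τ]
      -- `b + nT` in coordinates, through `(g_c, g_{−c})`
      obtain ⟨x', y', h', hQ, hx'⟩ :=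
        exists_eq_some_of_add_nsmul_T hV hnsb hxb0 (kummerExp a (resGal (K := K) E τ)).val
      have hgp : gFunW (cE E c) (Affine.Point.some x' y' h') = 0 := by
        have := gFunW_add_nsmul_T hV hθ hcE0 (ε := 1) (by norm_num) (Affine.Point.some _ _ hnsb)
          (kummerExp a (resGal (K := K) E τ)).val
        rw [one_mul, hQ] at this
        rw [this, gFunW_some, neg_add_cancel, zero_div, mul_zero]
      have hgm : gFunW (-cE E c) (Affine.Point.some x' y' h') =
          (iotaE (K := K) E (omega K) ^ 2) ^ (kummerExp a (resGal (K := K) E τ)).val *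
            ((-(3 * cE E c) + 3 * -cE E c) /
              (algebraMap E (AlgebraicClosure E) (w / 3) * iotaE (K := K) E (cubeRoot a))) := by
        have := gFunW_add_nsmul_T hV hθ hcE0 (ε := -1) (by norm_num) (Affine.Point.some _ _ hnsb)
          (kummerExp a (resGal (K := K) E τ)).val
        rw [neg_one_mul, neg_one_mul, hQ, hω2] at this
        rw [this, gFunW_some]
      obtain ⟨hxQ, hyQ⟩ := coords_eq_of_gFunW hcE0 h' hx'
      rw [hgp, hgm] at hxQ
      rw [hgp, zero_mul, zero_sub] at hyQ
      obtain ⟨xb, hxbdef⟩ : ∃ xb : AlgebraicClosure E,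
          xb = algebraMap E (AlgebraicClosure E) (w / 3) * iotaE (K := K) E (cubeRoot a) := ⟨_, rfl⟩
      rw [← hxbdef] at hxQ hxb0
      have hx'' : x' = iotaE (K := K) E (omega K) ^ (kummerExp a (resGal (K := K) E τ)).val * xb := by
        rw [hxQ]
        have h6 : (6 : AlgebraicClosure E) * cE E c ≠ 0 := mul_ne_zero (by norm_num) hcE0
        have hωn : (iotaE (K := K) E (omega K) ^ 2) ^ (kummerExp a (resGal (K := K) E τ)).val ≠ 0 :=
          pow_ne_zero _ (pow_ne_zero _ hω0)
        rw [show (-(3 * cE E c) + 3 * -cE E c) = -(6 * cE E c) by ring, neg_div, mul_neg, sub_neg_eq_add,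
          zero_add, div_eq_iff (mul_ne_zero hωn (div_ne_zero h6 hxb0))]
        field_simp
        linear_combination (-1 : AlgebraicClosure E) * h3n (kummerExp a (resGal (K := K) E τ)).val
      -- `τ b = (ω^n x_b, −3c) = b + nT`
      have hτb : τ • (show localPoints (mordellCurve D) E from Affine.Point.some _ _ hnsb) =
          (show localPoints (mordellCurve D) E from Affine.Point.some x' y' h') := by
        rw [smul_localPoints_some τ hnsb (nonsingular_galAutE τ hnsb)]
        refine point_some_ext ?_ ?_
        · rw [map_mul, hτE, hτα τ, hx'', hxbdef]; ring
        · rw [hyQ, map_neg, map_mul, map_ofNat, galAutE_cE]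
      rw [hτb]
      exact eq_sub_of_add_eq' hQ
    · /- generic `P'`: `Y₀ + 9c = a w³`; `b` = the explicit `φ`-preimage with `g_c(b) = w ι∛a` -/
      rw [if_neg hY] at hδ
      have hγ3 : (algebraMap E (AlgebraicClosure E) w * iotaE (K := K) E (cubeRoot a)) ^ 3 =
          algebraMap E (AlgebraicClosure E) Y₀ + 9 * cE E c := by
        rw [mul_pow, hα3, haE, ← map_pow, ← map_mul, mul_comm, ← hδ, map_add, map_mul, map_ofNat, ← hcE']
      have hγ0 : algebraMap E (AlgebraicClosure E) w * iotaE (K := K) E (cubeRoot a) ≠ 0 :=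
        mul_ne_zero hwE hα0
      have hEqb := preim_equation hcE0 hγ3 hγ0 hE'bar
      have hnsb : ((mordellCurve D).baseChange (AlgebraicClosure E)).toAffine.Nonsingular
          (preimX (cE E c) (algebraMap E (AlgebraicClosure E) X₀)
            (algebraMap E (AlgebraicClosure E) w * iotaE (K := K) E (cubeRoot a)))
          (preimY (cE E c) (algebraMap E (AlgebraicClosure E) X₀)
            (algebraMap E (AlgebraicClosure E) w * iotaE (K := K) E (cubeRoot a))) :=
        (Affine.equation_iff_nonsingular_of_Δ_ne_zero hV.Δ_ne).mp
          ((IsVeluPair.equation_iff' hV hθ _ _).mpr hEqb)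
      have hxb0 := preimX_ne_zero hcE0 hγ3 hγ0 hE'bar
      refine ⟨Affine.Point.some _ _ hnsb, fun τ => ?_⟩
      rw [pointsMap_torsorCocycle hc hD ha τ]
      obtain ⟨x', y', h', hQ, hx'⟩ :=
        exists_eq_some_of_add_nsmul_T hV hnsb hxb0 (kummerExp a (resGal (K := K) E τ)).val
      have hgp : gFunW (cE E c) (Affine.Point.some x' y' h') =
          iotaE (K := K) E (omega K) ^ (kummerExp a (resGal (K := K) E τ)).val *
            (algebraMap E (AlgebraicClosure E) w * iotaE (K := K) E (cubeRoot a)) := by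
        have := gFunW_add_nsmul_T hV hθ hcE0 (ε := 1) (by norm_num) (Affine.Point.some _ _ hnsb)
          (kummerExp a (resGal (K := K) E τ)).val
        rw [one_mul, hQ, gFunW_preim hcE0 hγ3 hγ0 hE'bar, one_mul, ← hωθ] at this
        exact this
      have hgm : gFunW (-cE E c) (Affine.Point.some x' y' h') =
          (iotaE (K := K) E (omega K) ^ 2) ^ (kummerExp a (resGal (K := K) E τ)).val *
            (algebraMap E (AlgebraicClosure E) X₀ /
              (algebraMap E (AlgebraicClosure E) w * iotaE (K := K) E (cubeRoot a))) := by
        have := gFunW_add_nsmul_T hV hθ hcE0 (ε := -1) (by norm_num) (Affine.Point.some _ _ hnsb)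
          (kummerExp a (resGal (K := K) E τ)).val
        rw [neg_one_mul, neg_one_mul, hQ, gFunW_neg_preim hcE0 hγ3 hγ0 hE'bar, hω2] at this
        exact this
      obtain ⟨hxQ, hyQ⟩ := coords_eq_of_gFunW hcE0 h' hx'
      -- `X₀/(ω^n γ) = ω^{2n} X₀/γ`
      have hX : algebraMap E (AlgebraicClosure E) X₀ /
          (iotaE (K := K) E (omega K) ^ (kummerExp a (resGal (K := K) E τ)).val *
            (algebraMap E (AlgebraicClosure E) w * iotaE (K := K) E (cubeRoot a))) =
          (iotaE (K := K) E (omega K) ^ 2) ^ (kummerExp a (resGal (K := K) E τ)).val *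
            (algebraMap E (AlgebraicClosure E) X₀ /
              (algebraMap E (AlgebraicClosure E) w * iotaE (K := K) E (cubeRoot a))) := by
        have hωn0 : iotaE (K := K) E (omega K) ^ (kummerExp a (resGal (K := K) E τ)).val ≠ 0 :=
          pow_ne_zero _ hω0
        field_simp
        linear_combination (-(algebraMap E (AlgebraicClosure E) X₀)) *
          h3n (kummerExp a (resGal (K := K) E τ)).val
      have hx'' : x' = preimX (cE E c) (algebraMap E (AlgebraicClosure E) X₀)
          (iotaE (K := K) E (omega K) ^ (kummerExp a (resGal (K := K) E τ)).val *
            (algebraMap E (AlgebraicClosure E) w * iotaE (K := K) E (cubeRoot a))) := by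
        rw [hxQ, hgp, hgm, preimX, hX]
      have hy'' : y' = preimY (cE E c) (algebraMap E (AlgebraicClosure E) X₀)
          (iotaE (K := K) E (omega K) ^ (kummerExp a (resGal (K := K) E τ)).val *
            (algebraMap E (AlgebraicClosure E) w * iotaE (K := K) E (cubeRoot a))) := by
        rw [hyQ, hgp, hx'', preimY]
      have hτγ : galAutE E τ (algebraMap E (AlgebraicClosure E) w * iotaE (K := K) E (cubeRoot a)) =
          iotaE (K := K) E (omega K) ^ (kummerExp a (resGal (K := K) E τ)).val *
            (algebraMap E (AlgebraicClosure E) w * iotaE (K := K) E (cubeRoot a)) := by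
        rw [map_mul, hτE, hτα τ]; ring
      -- `τ b = preim(c, X₀, ω^n γ) = b + nT`
      have hτb : τ • (show localPoints (mordellCurve D) E from Affine.Point.some _ _ hnsb) =
          (show localPoints (mordellCurve D) E from Affine.Point.some x' y' h') := by
        rw [smul_localPoints_some τ hnsb (nonsingular_galAutE τ hnsb)]
        refine point_some_ext ?_ ?_
        · rw [map_preimX, galAutE_cE, hτE, hτγ, hx'']
        · rw [map_preimY, galAutE_cE, hτE, hτγ, hy'']
      rw [hτb]
      exact eq_sub_of_add_eq' hQ

end Local

end MordellDescent

end Literature.NumberTheory.EllipticCurves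

end
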